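import Summits.BirchSwinnertonDyer.BirchSwinnertonDyer.Theorems.AdditiveBranchIMCGordTwoRankOneUnitSliceCrux
import Summits.BirchSwinnertonDyer.BirchSwinnertonDyer.Theorems.AdditiveBranchIMCGordTwoRankOneUnitCoeff
import Summits.BirchSwinnertonDyer.Rank1Residual.Supersingular.DescentLowerBoundRankOne
import HarnessLib

/-!
# Route `AdditiveBranchIMC` (rung K1), crux `GordTwoRankOne` (item 19358): the CONTENT WINDOW at `p = 3` per pair —
# on a (G-ord, `e = 2`) rank-one row with `3 ∣ #Ш(E)_an` the lower half is an exact `3`-descent certificate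
# (class-free, b2b), the upper half is Wuthrich's / Kato's half + `A′(E,3) ≠ 0`
# (cell `bsd-addord`, seat `bsd-addord-k1-c3` gen 5, D-0074 row B2; sequel of `…GordTwoRankOneShaAnUnit`)

HONEST FRAMING. THEOREMS ONLY: no definition, no named fact, no `sorry`, nothing booked; BSD is not proved by
any of this; the crux stays OPEN at class level on its content window `p ∣ #Ш(E)_an` (Λ-adic children 19497 /
19498, NOT in print; certificate child 19499). This file is the PER-PAIR reading of that window at the one prime
where the cell owns descent engines, `p = 3`.

WHAT. The companion file `…GordTwoRankOneShaAnUnit` reads the crux's lower half `Typed.MissingLowerBoundAt W p`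
(`ord_p #Ш_an ≤ ord_p #Ш`) for free on the rows with `ord_p #Ш(E)_an ≤ 0` and leaves the window `p ∣ #Ш(E)_an`.
On the window the lower half asks for `p^{ord_p #Ш_an} ∣ #Ш(E)` — an existence-of-`Ш` statement, which at
`p = 3` is what the b2b cell's EXACT `3`-descent delivers per pair: `3^{r_an + 1} ∣ #Sel^(3)(E/ℚ)` with
`3 ∤ #E(ℚ)_tors` forces `Ш(E)[3] ≠ 0`, and Cassels–Tate squareness (`hCT`, PUBLISHED) gives `9 ∣ #Ш(E)` — the
class-free kernel `Supersingular.missingLowerBoundAt_of_casselsTate_of_pow_succ_dvd_card_selmerGroup`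
(`DescentLowerBoundRankOne.lean`; valid at any prime, any reduction type; it asks `ord_p #Ш_an ≤ 2`). Composed with
the seat's gen-0 UPPER halves from the kernel identity (Wuthrich's half on X3♯, Kato's half on X4♯ ∩ surj;
Schneider = the identity with `A′ ≠ 0`):

* §1 `classX3Gord_bsdp_rankOne_three_of_wuthrichHalf_of_branchCoeffOneNeZero_of_descent` — X3♯(G-ord) at `3`,
  `r_an = 1`, anomalous or not, Case-1 line datum or not: `BSD(E,3)` ⟸ `hW16` + `hCT` + cite-only
  `hCyc hArt h73 hWald hmod hmodD hmodN hGZK` + `A′(E,3) ≠ 0` + the data `#Ш(E)_an = s`, `ord_3 s ≤ 2`,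
  `3 ∤ #E(ℚ)_tors`, `3^{2} ∣ #Sel^(3)(E/ℚ)`.
* §2 `classX4Gord_bsdp_rankOne_three_of_katoHalf_of_branchCoeffOneNeZero_of_descent` — X4♯(G-ord) at `3` ∩
  {`ρ̄_{E,3}` onto}: the same with `hK`, the torsion clause automatic (`E[3]` irreducible).
* §3 `classX{3,4}Gord_bsdp_rankOne_three_…_of_window` — ONE door per image type for the whole `p = 3` universe:
  the lower half supplied EITHER by the unit datum (`ord_3 s ≤ 0`) OR by the descent certificate.

NUMBERS (cell table `HOME/planner/bx3g/r1_keys_799.tsv`, column `ordp_sha_max`; EVIDENCE, not a kernel input): of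
the 799 B6 X3♯(G-ord, `e = 2`) r1 keys 797 have `ord_p #Ш_an = 0` (all 119 keys at `p ∈ {5, 7, 13}`, 678 / 680 at
`p = 3`); the two content keys are `196794ci@3` and `491985u@3` with `ord_3 #Ш_an = 2` — §1's shape. So at
certificate grade every B6 X3♯ r1 key is reached by `…ShaAnUnit` §2 or by §1 here from: Wuthrich's reading, the
cite-only facts, `A′ ≠ 0` (the A′ engines), the `#Ш_an` datum, and — for the two content keys — one exact
`3`-descent line each (the cell's x10b / x11b engines). NO line datum `Φ₀`, NO anomalous split, NO Case-1 member.

NOT here: any evaluation of a Selmer group or of `#Ш_an`; any class statement; `p ≥ 5` content rows (no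
`p`-descent instrument; there the window is the Λ-adic children's); the (M) and defect-`3,4,6` cells.

References: [SilvermanAEC2009] X.4.2, X.4.14; [Cassels1962IV]; [Miller2011LMS] §1, Def. 1.1; [Wuthrich2014] Thm. 16;
[Kato2004Asterisque] Thm. 17.4 (3); [Delbourgo2002] Thm. (B), Example (p. 40); [Disegni2017] Thm. A, B; cell
TARGET.md §2 (content windows), HOME/planner/bx3g/r1_keys_799.tsv, HOME/k1-c3/CERT-ROADS-19358-g5.md.
-/

set_option autoImplicit false
set_option linter.dupNamespace false
noncomputable section
open scoped Classical MatrixGroups ModularForm NumberField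
open CongruenceSubgroup WeierstrassCurve NumberField IsDedekindDomain Field
  Literature.NumberTheory.EllipticCurves Literature.NumberTheory.EllipticCurves.ModularForms
  Literature.NumberTheory.EllipticCurves.GreenbergVatsal2000
  Literature.NumberTheory.EllipticCurves.Rank1Residual
  Literature.NumberTheory.EllipticCurves.Rank1Residual.Typed
  Literature.NumberTheory.EllipticCurves.Delbourgo2002
  Literature.NumberTheory.EllipticCurves.Disegni2017
  Literature.NumberTheory.GaloisRepresentations
  Summit.BirchSwinnertonDyer.Rank1Residual.AdditivePotMult
  Summit.BirchSwinnertonDyer.Rank1Residual.Additive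
  Summit.BirchSwinnertonDyer.Rank1Residual.Supersingular

namespace Summit.BirchSwinnertonDyer.BirchSwinnertonDyer.Theorems.AdditiveBranchIMCGordTwoRankOne

/-! ### §1 X3♯(G-ord) at `p = 3`, content window: Wuthrich's half + `A′ ≠ 0` + exact `3`-descent -/

/-- **X3♯(G-ord) at `p = 3` (`E[3]` reducible, `e = 2` automatic), `r_an(E) = 1`, ANOMALOUS OR NOT, line datum OR
NOT, on the CONTENT WINDOW: `BSD(E,3)` from Wuthrich's half-eigenspace reading `hW16`, Cassels–Tate `hCT`, the
cite-only facts `hCyc hArt h73 hWald hmod hmodD hmodN hGZK`, the weak certificate `A′(E,3) ≠ 0`, and the per-pair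
data `#Ш(E)_an = s` with `ord_3 s ≤ 2`, `3 ∤ #E(ℚ)_tors`, `3^{r_an+1} = 9 ∣ #Sel^(3)(E/ℚ)`.** LOWER half = b2b's
class-free `missingLowerBoundAt_of_casselsTate_of_pow_succ_dvd_card_selmerGroup` (`Ш[3] ≠ 0`, squareness);
UPPER half = `ClassX3Gord.missingUpperBoundAt_rankOne_of_wuthrichHalf_of_identity_odd` at `3` on the datum and
identity of `exists_datum_identity_three_of_facts`, Schneider from `A′ ≠ 0`; `¬CM` automatic. Nothing booked.
[cite: SilvermanAEC2009, Thm. X.4.2, X.4.14] [cite: Wuthrich2014, Thm. 16 (p. 397)]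
[cite: Delbourgo2002, Theorem (B), Example (p. 40)] [cite: Disegni2017, Theorem A/B (arXiv v3 PDF 7–9)]
[cite: Miller2011LMS, Def. 1.1] -/
theorem classX3Gord_bsdp_rankOne_three_of_wuthrichHalf_of_branchCoeffOneNeZero_of_descent
    [Fact (Nat.Prime 3)] {W : WeierstrassCurve ℚ} [W.IsElliptic] [W.IsGloballyMinimal]
    (hW16 : Wuthrich2014.thm16_halfEigenCharIdeal_dvd_cyclotomicPrime)
    (hCT : exists_casselsTate_pairing (K := ℚ)) (hCyc : delbourgoDatum_cycLineGrossZagier)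
    (hArt : rankinSelbergEulerProductHecke_baseChangeDirichlet_eq) (h73 : GrossZagier1986_thm_I_7_3)
    (hWald : waldspurger_exists_heegnerField_twist_ne_zero)
    (hmod : hasEntireLFunction_rat) (hmodD : nonempty_modularParametrizationData)
    (hmodN : exists_isNewformOf) (hGZK : rank_eq_analyticRank_of_analyticRank_le_one)
    (hX : ClassX3Gord W 3) (hr : W.analyticRank = 1) (hne : BranchCoeffOneNeZeroAt W 3)
    (htors : ¬ 3 ∣ W.torsionOrder) {s : ℚ} (hs : shaAn W = (s : ℂ)) (hsv : padicValRat 3 s ≤ 2)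
    (hcard : 3 ^ (W.analyticRank + 1) ∣ Nat.card (W.selmerGroup ((3 : ℕ) : ℤ))) : BSDp W 3 := by
  have hp4 : (3 : ℕ) % 4 = 3 := by norm_num
  have hp2 : (3 : ℕ) ≠ 2 := by norm_num
  have hcm : ¬ W.HasCM := not_hasCM_of_classX3Gord hX hp2
  have he : semistabilityIndex W 3 = 2 :=
    semistabilityIndex_eq_two_of_typeG_three W hX.typeGOrd.typeG hX.addv
  obtain ⟨V, iV, iVm, C, hV, hC⟩ := hX.exists_goodOrd_pStar_twist_model W 3 hp2 he
  have hordin : IsOrdinaryAt V 3 := ⟨hV.1, hV.2⟩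
  haveI : NeZero (V.conductorNorm ℤ) := ⟨(V.conductorNorm_pos_holds).ne'⟩
  obtain ⟨Dm⟩ := hmodD V
  obtain ⟨ϖ, -, hϖ⟩ := exists_rat_mul_imaginaryPeriodRat_eq_minusPeriod Dm
  obtain ⟨Dh, hB, u, q, hlead, hpgz⟩ := exists_datum_identity_three_of_facts hCyc hArt h73 hWald hmod hmodD
    hmodN hGZK hX.addv hX.typeGOrd hcm hr V C hV hC Dm.isNewformOf ϖ hϖ
  have hSch : SchneiderConjecture Dh :=
    schneiderConjecture_of_identity_of_branchCoeffOneNeZero_odd hp4 hne V C hC hordin Dm.f Dm.isNewformOf ϖ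
      hϖ hpgz
  have hu : MissingUpperBoundAt W 3 :=
    ClassX3Gord.missingUpperBoundAt_rankOne_of_wuthrichHalf_of_identity_odd hW16 hGZK hmod hX hp4 hr hB hSch V hV C
      hC Dm.isNewformOf ϖ hϖ hlead hpgz
  have hl : MissingLowerBoundAt W 3 :=
    missingLowerBoundAt_of_casselsTate_of_pow_succ_dvd_card_selmerGroup W 3 hCT hGZK (by rw [hr]) htors hs hsv
      hcard
  exact bsdp_of_missingPPartAt W 3 hGZK (by rw [hr]) (missingPPartAt_of_lower_of_upper W 3 hl hu)

/-! ### §2 X4♯(G-ord) at `p = 3` ∩ {`ρ̄` onto}, content window: Kato's half + `A′ ≠ 0` + exact `3`-descent -/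

/-- **X4♯(G-ord) at `p = 3` (`e = 2` automatic) ∩ {`ρ̄_{E,3}` onto}, `r_an(E) = 1`, ANOMALOUS OR NOT, on the CONTENT
WINDOW: `BSD(E,3)` from Kato's half `hK`, Cassels–Tate `hCT`, the cite-only facts, `A′(E,3) ≠ 0`, and the data
`#Ш(E)_an = s` with `ord_3 s ≤ 2`, `9 ∣ #Sel^(3)(E/ℚ)`** (`3 ∤ #E(ℚ)_tors` is automatic: `E[3]` irreducible,
`not_dvd_torsionOrder_of_irr`). UPPER = `classX4Gord_missingUpperBoundAt_rankOne_of_katoHalf_of_identity_odd` at `3`;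
LOWER = b2b's descent kernel. Nothing booked. [cite: SilvermanAEC2009, Thm. X.4.2, X.4.14]
[cite: Kato2004Asterisque, Thm. 17.4 (3) (p. 273)] [cite: Delbourgo2002, Theorem (B), Example (p. 40)]
[cite: Disegni2017, Theorem A/B (arXiv v3 PDF 7–9)] [cite: Miller2011LMS, Def. 1.1] -/
theorem classX4Gord_bsdp_rankOne_three_of_katoHalf_of_branchCoeffOneNeZero_of_descent
    [Fact (Nat.Prime 3)] {W : WeierstrassCurve ℚ} [W.IsElliptic] [W.IsGloballyMinimal]
    (hK : Wuthrich2014.kato_halfEigenCharIdeal_dvd_cyclotomicPrime_of_surjective)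
    (hCT : exists_casselsTate_pairing (K := ℚ)) (hCyc : delbourgoDatum_cycLineGrossZagier)
    (hArt : rankinSelbergEulerProductHecke_baseChangeDirichlet_eq) (h73 : GrossZagier1986_thm_I_7_3)
    (hWald : waldspurger_exists_heegnerField_twist_ne_zero)
    (hmod : hasEntireLFunction_rat) (hmodD : nonempty_modularParametrizationData)
    (hmodN : exists_isNewformOf) (hGZK : rank_eq_analyticRank_of_analyticRank_le_one)
    (hX : ClassX4Gord W 3) (hsurj : Surj W 3) (hr : W.analyticRank = 1) (hne : BranchCoeffOneNeZeroAt W 3)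
    {s : ℚ} (hs : shaAn W = (s : ℂ)) (hsv : padicValRat 3 s ≤ 2)
    (hcard : 3 ^ (W.analyticRank + 1) ∣ Nat.card (W.selmerGroup ((3 : ℕ) : ℤ))) : BSDp W 3 := by
  have hp4 : (3 : ℕ) % 4 = 3 := by norm_num
  have hp2 : (3 : ℕ) ≠ 2 := by norm_num
  have hcm : ¬ W.HasCM := not_hasCM_of_surj_of_ne_two hp2 hsurj
  have he : semistabilityIndex W 3 = 2 :=
    semistabilityIndex_eq_two_of_typeG_three W hX.typeGOrd.typeG hX.addv.2
  obtain ⟨V, iV, iVm, C, hV, hC⟩ := hX.exists_goodOrd_pStar_twist_model W 3 he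
  have hordin : IsOrdinaryAt V 3 := ⟨hV.1, hV.2⟩
  haveI : NeZero (V.conductorNorm ℤ) := ⟨(V.conductorNorm_pos_holds).ne'⟩
  obtain ⟨Dm⟩ := hmodD V
  obtain ⟨ϖ, -, hϖ⟩ := exists_rat_mul_imaginaryPeriodRat_eq_minusPeriod Dm
  obtain ⟨Dh, hB, u, q, hlead, hpgz⟩ := exists_datum_identity_three_of_facts hCyc hArt h73 hWald hmod hmodD
    hmodN hGZK hX.addv.2 hX.typeGOrd hcm hr V C hV hC Dm.isNewformOf ϖ hϖ
  have hSch : SchneiderConjecture Dh :=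
    schneiderConjecture_of_identity_of_branchCoeffOneNeZero_odd hp4 hne V C hC hordin Dm.f Dm.isNewformOf ϖ
      hϖ hpgz
  have hu : MissingUpperBoundAt W 3 :=
    classX4Gord_missingUpperBoundAt_rankOne_of_katoHalf_of_identity_odd hK hGZK hmod hX hp4 hsurj hr hB hSch V hV
      C hC Dm.isNewformOf ϖ hϖ hlead hpgz
  have hl : MissingLowerBoundAt W 3 :=
    missingLowerBoundAt_of_casselsTate_of_pow_succ_dvd_card_selmerGroup W 3 hCT hGZK (by rw [hr])
      (not_dvd_torsionOrder_of_irr W 3 hX.classX4.2.2) hs hsv hcard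
  exact bsdp_of_missingPPartAt W 3 hGZK (by rw [hr]) (missingPPartAt_of_lower_of_upper W 3 hl hu)

/-! ### §3 The whole `p = 3` universe per pair: unit datum OR descent certificate -/

/-- **ONE DOOR for the B6 X3♯ r1 universe at `p = 3`.** X3♯(G-ord) at `3`, `r_an(E) = 1`, anomalous or not, line
datum or not: `BSD(E,3)` from `hW16`, `hCT`, the cite-only facts, `A′(E,3) ≠ 0`, the datum `#Ш(E)_an = s ∈ ℚ`, and
EITHER `ord_3 s ≤ 0` (unit window: 678 / 680 keys of the cell's table) OR the content-window certificate
(`ord_3 s ≤ 2`, `3 ∤ #E(ℚ)_tors`, `9 ∣ #Sel^(3)(E/ℚ)`: the two keys `196794ci`, `491985u`). The unit branch re-proves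
`…ShaAnUnit` §2 at `3` inline (that file is a sibling, not an import). Nothing booked.
[cite: Wuthrich2014, Thm. 16 (p. 397)] [cite: SilvermanAEC2009, Thm. X.4.14] [cite: Miller2011LMS, Def. 1.1] -/
theorem classX3Gord_bsdp_rankOne_three_of_wuthrichHalf_of_branchCoeffOneNeZero_of_window
    [Fact (Nat.Prime 3)] {W : WeierstrassCurve ℚ} [W.IsElliptic] [W.IsGloballyMinimal]
    (hW16 : Wuthrich2014.thm16_halfEigenCharIdeal_dvd_cyclotomicPrime)
    (hCT : exists_casselsTate_pairing (K := ℚ)) (hCyc : delbourgoDatum_cycLineGrossZagier)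
    (hArt : rankinSelbergEulerProductHecke_baseChangeDirichlet_eq) (h73 : GrossZagier1986_thm_I_7_3)
    (hWald : waldspurger_exists_heegnerField_twist_ne_zero)
    (hmod : hasEntireLFunction_rat) (hmodD : nonempty_modularParametrizationData)
    (hmodN : exists_isNewformOf) (hGZK : rank_eq_analyticRank_of_analyticRank_le_one)
    (hX : ClassX3Gord W 3) (hr : W.analyticRank = 1) (hne : BranchCoeffOneNeZeroAt W 3)
    {s : ℚ} (hs : shaAn W = (s : ℂ))
    (hwin : padicValRat 3 s ≤ 0 ∨
      (padicValRat 3 s ≤ 2 ∧ ¬ 3 ∣ W.torsionOrder ∧ 3 ^ (W.analyticRank + 1) ∣ Nat.card (W.selmerGroup ((3 : ℕ) : ℤ)))) :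
    BSDp W 3 := by
  rcases hwin with h0 | ⟨h2, htors, hcard⟩
  · -- unit window: the lower half is free; upper half as in §1
    have hp4 : (3 : ℕ) % 4 = 3 := by norm_num
    have hp2 : (3 : ℕ) ≠ 2 := by norm_num
    have hcm : ¬ W.HasCM := not_hasCM_of_classX3Gord hX hp2
    have he : semistabilityIndex W 3 = 2 :=
      semistabilityIndex_eq_two_of_typeG_three W hX.typeGOrd.typeG hX.addv
    obtain ⟨V, iV, iVm, C, hV, hC⟩ := hX.exists_goodOrd_pStar_twist_model W 3 hp2 he
    have hordin : IsOrdinaryAt V 3 := ⟨hV.1, hV.2⟩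
    haveI : NeZero (V.conductorNorm ℤ) := ⟨(V.conductorNorm_pos_holds).ne'⟩
    obtain ⟨Dm⟩ := hmodD V
    obtain ⟨ϖ, -, hϖ⟩ := exists_rat_mul_imaginaryPeriodRat_eq_minusPeriod Dm
    obtain ⟨Dh, hB, u, q, hlead, hpgz⟩ := exists_datum_identity_three_of_facts hCyc hArt h73 hWald hmod hmodD
      hmodN hGZK hX.addv hX.typeGOrd hcm hr V C hV hC Dm.isNewformOf ϖ hϖ
    have hSch : SchneiderConjecture Dh :=
      schneiderConjecture_of_identity_of_branchCoeffOneNeZero_odd hp4 hne V C hC hordin Dm.f Dm.isNewformOf ϖ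
        hϖ hpgz
    have hu : MissingUpperBoundAt W 3 :=
      ClassX3Gord.missingUpperBoundAt_rankOne_of_wuthrichHalf_of_identity_odd hW16 hGZK hmod hX hp4 hr hB hSch V hV
        C hC Dm.isNewformOf ϖ hϖ hlead hpgz
    exact bsdp_of_missingPPartAt W 3 hGZK (by rw [hr])
      (missingPPartAt_of_lower_of_upper W 3 ⟨s, hs, h0.trans (by positivity)⟩ hu)
  · exact classX3Gord_bsdp_rankOne_three_of_wuthrichHalf_of_branchCoeffOneNeZero_of_descent hW16 hCT hCyc hArt
      h73 hWald hmod hmodD hmodN hGZK hX hr hne htors hs h2 hcard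

/-- **ONE DOOR for X4♯(G-ord) at `3` ∩ {`ρ̄_{E,3}` onto}, `r_an = 1`**: `BSD(E,3)` from `hK`, `hCT`, the cite-only
facts, `A′(E,3) ≠ 0`, `#Ш(E)_an = s`, and EITHER `ord_3 s ≤ 0` OR (`ord_3 s ≤ 2` ∧ `9 ∣ #Sel^(3)(E/ℚ)`).
Nothing booked. [cite: Kato2004Asterisque, Thm. 17.4 (3) (p. 273)] [cite: SilvermanAEC2009, Thm. X.4.14]
[cite: Miller2011LMS, Def. 1.1] -/
theorem classX4Gord_bsdp_rankOne_three_of_katoHalf_of_branchCoeffOneNeZero_of_window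
    [Fact (Nat.Prime 3)] {W : WeierstrassCurve ℚ} [W.IsElliptic] [W.IsGloballyMinimal]
    (hK : Wuthrich2014.kato_halfEigenCharIdeal_dvd_cyclotomicPrime_of_surjective)
    (hCT : exists_casselsTate_pairing (K := ℚ)) (hCyc : delbourgoDatum_cycLineGrossZagier)
    (hArt : rankinSelbergEulerProductHecke_baseChangeDirichlet_eq) (h73 : GrossZagier1986_thm_I_7_3)
    (hWald : waldspurger_exists_heegnerField_twist_ne_zero)
    (hmod : hasEntireLFunction_rat) (hmodD : nonempty_modularParametrizationData)
    (hmodN : exists_isNewformOf) (hGZK : rank_eq_analyticRank_of_analyticRank_le_one)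
    (hX : ClassX4Gord W 3) (hsurj : Surj W 3) (hr : W.analyticRank = 1) (hne : BranchCoeffOneNeZeroAt W 3)
    {s : ℚ} (hs : shaAn W = (s : ℂ))
    (hwin : padicValRat 3 s ≤ 0 ∨
      (padicValRat 3 s ≤ 2 ∧ 3 ^ (W.analyticRank + 1) ∣ Nat.card (W.selmerGroup ((3 : ℕ) : ℤ)))) :
    BSDp W 3 := by
  rcases hwin with h0 | ⟨h2, hcard⟩
  · have hp4 : (3 : ℕ) % 4 = 3 := by norm_num
    have hp2 : (3 : ℕ) ≠ 2 := by norm_num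
    have hcm : ¬ W.HasCM := not_hasCM_of_surj_of_ne_two hp2 hsurj
    have he : semistabilityIndex W 3 = 2 :=
      semistabilityIndex_eq_two_of_typeG_three W hX.typeGOrd.typeG hX.addv.2
    obtain ⟨V, iV, iVm, C, hV, hC⟩ := hX.exists_goodOrd_pStar_twist_model W 3 he
    have hordin : IsOrdinaryAt V 3 := ⟨hV.1, hV.2⟩
    haveI : NeZero (V.conductorNorm ℤ) := ⟨(V.conductorNorm_pos_holds).ne'⟩
    obtain ⟨Dm⟩ := hmodD V
    obtain ⟨ϖ, -, hϖ⟩ := exists_rat_mul_imaginaryPeriodRat_eq_minusPeriod Dm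
    obtain ⟨Dh, hB, u, q, hlead, hpgz⟩ := exists_datum_identity_three_of_facts hCyc hArt h73 hWald hmod hmodD
      hmodN hGZK hX.addv.2 hX.typeGOrd hcm hr V C hV hC Dm.isNewformOf ϖ hϖ
    have hSch : SchneiderConjecture Dh :=
      schneiderConjecture_of_identity_of_branchCoeffOneNeZero_odd hp4 hne V C hC hordin Dm.f Dm.isNewformOf ϖ
        hϖ hpgz
    have hu : MissingUpperBoundAt W 3 :=
      classX4Gord_missingUpperBoundAt_rankOne_of_katoHalf_of_identity_odd hK hGZK hmod hX hp4 hsurj hr hB hSch V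
        hV C hC Dm.isNewformOf ϖ hϖ hlead hpgz
    exact bsdp_of_missingPPartAt W 3 hGZK (by rw [hr])
      (missingPPartAt_of_lower_of_upper W 3 ⟨s, hs, h0.trans (by positivity)⟩ hu)
  · exact classX4Gord_bsdp_rankOne_three_of_katoHalf_of_branchCoeffOneNeZero_of_descent hK hCT hCyc hArt h73
      hWald hmod hmodD hmodN hGZK hX hsurj hr hne hs h2 hcard

end Summit.BirchSwinnertonDyer.BirchSwinnertonDyer.Theorems.AdditiveBranchIMCGordTwoRankOne

end
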